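import Mathlib.Analysis.SpecialFunctions.Pow.Real
import HarnessLib

/-!
# QUANT lane R8, T-DEC: THE CROSSED TYPE II LOW-CROSS CELL (lower cross cell a giant) — the real inequalities: certificate (★★),
# the breakpoint inequality (★) of the heavy row-`p` cross pair, and the two-term knapsack bound (census-2 g59)

builds on p205010 (kernel theorem, internal audit signed; external expert review pending)

Support file (`--supports stmt-CriticalPhenomena-4575`), QUANT lane seat prim-quant-census-2 (gen 59), rung R8 of
`run/shared/lean/prim/quant/LADDER.md`.  Memo `run/shared/lean/prim/quant/prim-quant-census-2-g59/ASSEMBLY-G59.md` §4–§5.  Pure real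
analysis; theorems only, standard axioms, no sorries, no definitions.

THE CELL.  In the class `LightSliceLowCross` ∩ {crossed Type II, `p + h ≥ j + 1`} the light slice has lows `P1 = p+l, P2 = p+l′, M1 = m+l,
M2 = m+l′`, ONE mid `p + h′` (mass `(1−γ)m_C c₂`) and giants of mass `G = u·L − mid` (the atom's all-giant balance: `m_E c₁ + m_C c₂ = x = u(1−x)`,
`L = m_E + m_C = 1 − x`).  With the balance the knapsack inequality of `decAtT_of_singleMid` reads
`(1−γ)c₂(θ/u − 1) ≤ Σ_q mass_q (θ − usage_q)⁺`, and the terms of `M2` (always compatible and LIGHT) and `P2` alone suffice: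
* **`starstar_cert`** — (★★) `(1 − 2γ)·r·(1 + a) ≤ γ·(2 − x − r)·(1 − x − r a)` for `0 < x < 1`, `0 ≤ r ≤ x`, `0 ≤ a`, `(2 − r)a ≤ x`,
  `γ = x² + (1−x)r ≤ 1/2` — a 25-term Handelman certificate (census-1 g20's `cert.py` engine; `out/cert/starstar_cert.json`).
* **`star_of_rates`** — (★): for the light pair rate `r = ρ₁ < x`, the cheap rate `ρ_c < x`, the span ratio `a = A/B′` with the LOW CROSS
  `(2 − r)a < ρ_c`, `P = ρ_c + r a ∈ [x, 1)` (the row-`p` cross pair `P2` HEAVY and compatible), `M = (P − 2a)/(1 − a)` (the rate of `M2`):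
  `(1 − γ)·c₂·(c_P − u) ≤ u·γ·(c_P − c_M)` where `u = x/(1−x)`, `c₂ = U_ℓ(ρ_c)`, `c_M = U_ℓ(M)`, `c_P = P/(1−P)`, `U_ℓ(ρ) = (x²+(1−x)ρ)/((1−x)(1+x−ρ))`.
  (If `γ ≥ 1/2` it is immediate; else it reduces to (★★).)
* **`half_le_gamma_of_incompatible`** — if `P ≥ 1` (P2 incompatible) then `γ ≥ 1/2`.
* **`twoTerm_knapsack`** — for all `θ ≥ 0`: `γ·min(c_M, θ) + (1−γ)·(P2 compatible ? min(c_P, θ) : θ) ≤ (1−γ)c₂(1 − θ/u) + θ`, from `c₂ ≤ u`,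
  `c_M ≤ u`, (★) when `P2` is heavy-compatible and `γ ≥ 1/2` when it is incompatible.
EXACT EVIDENCE before the proof (`out/cells2`, `out/cert`): (★) 0 / 4 740 failures with 38 % minimal relative slack; (★★) 0 / 113 810, 45 %;
the M2+P2 reduction matches the full knapsack verdict on 30 000 samples; kit j163808: the class has 30 036 instances at M ≤ 8, all certified.

[this work]; certificate engine census-1 g20 `code/gen20/cert.py` (this lane).  The gluing rows served [cite: KozmaNitzan2024, Conjecture 3 (p. 15)];
product measure [cite: Grimmett1999, §1.3 p. 10].
-/

noncomputable section

namespace Summit.CriticalPhenomena.PercolationContinuityZ3.Theorems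

namespace Quant

namespace LawDec

namespace CrossGiantCell

/-- **(★★), by a 25-term Handelman certificate.** [this work] -/
theorem starstar_cert (x r a : ℝ) (hx0 : 0 < x) (hx1 : x < 1) (hr0 : 0 ≤ r) (hrx : r ≤ x) (ha0 : 0 ≤ a) (hlc : (2 - r) * a ≤ x)
    (hg : x ^ 2 + (1 - x) * r ≤ 1 / 2) :
    (1 - 2 * (x ^ 2 + (1 - x) * r)) * r * (1 + a) ≤ (x ^ 2 + (1 - x) * r) * (2 - x - r) * (1 - x - r * a) := by
  have h1x : 0 ≤ 1 - x := by linarith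
  have hxr : 0 ≤ x - r := by linarith
  have hlc' : 0 ≤ x - (2 - r) * a := by linarith
  have hg' : 0 ≤ 1 / 2 - (x ^ 2 + (1 - x) * r) := by linarith
  nlinarith [mul_nonneg (mul_nonneg (mul_nonneg hx0.le hx0.le) hx0.le) hg',
      mul_nonneg (mul_nonneg (mul_nonneg hx0.le hx0.le) h1x) hlc',
      mul_nonneg (mul_nonneg (mul_nonneg hx0.le hx0.le) hr0) hr0,
      mul_nonneg (mul_nonneg (mul_nonneg hx0.le hx0.le) hr0) ha0,
      mul_nonneg (mul_nonneg (mul_nonneg hx0.le hx0.le) hr0) hlc',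
      mul_nonneg (mul_nonneg (mul_nonneg hx0.le h1x) hr0) hlc',
      mul_nonneg (mul_nonneg (mul_nonneg hx0.le h1x) hxr) hg',
      mul_nonneg (mul_nonneg (mul_nonneg hx0.le hr0) hr0) hr0,
      mul_nonneg (mul_nonneg (mul_nonneg hx0.le hr0) hxr) ha0,
      mul_nonneg (mul_nonneg (mul_nonneg hx0.le hr0) hxr) hlc',
      mul_nonneg (mul_nonneg (mul_nonneg hx0.le hxr) hxr) hxr,
      mul_nonneg (mul_nonneg (mul_nonneg hx0.le hxr) hxr) hg',
      mul_nonneg (mul_nonneg (mul_nonneg h1x h1x) h1x) hr0,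
      mul_nonneg (mul_nonneg (mul_nonneg h1x h1x) hr0) hr0,
      mul_nonneg (mul_nonneg (mul_nonneg h1x h1x) hr0) hlc',
      mul_nonneg (mul_nonneg (mul_nonneg h1x h1x) hr0) hg',
      mul_nonneg (mul_nonneg (mul_nonneg h1x h1x) hxr) hxr,
      mul_nonneg (mul_nonneg (mul_nonneg h1x hr0) hr0) hr0,
      mul_nonneg (mul_nonneg (mul_nonneg h1x hr0) hr0) hg',
      mul_nonneg (mul_nonneg (mul_nonneg h1x hr0) hxr) hxr,
      mul_nonneg (mul_nonneg (mul_nonneg h1x hr0) hxr) hlc',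
      mul_nonneg (mul_nonneg (mul_nonneg h1x hr0) ha0) hg',
      mul_nonneg (mul_nonneg (mul_nonneg h1x hxr) hxr) ha0,
      mul_nonneg (mul_nonneg (mul_nonneg hr0 hr0) hr0) ha0,
      mul_nonneg (mul_nonneg hr0 hg') hg']

/-- if `γ = x² + (1−x)r ≤ 1/2` with `0 ≤ r ≤ x < 1` then `r + 2x ≤ 2` (used for `1 − x − ra ≥ 0`). -/
theorem r_add_two_x_le (x r : ℝ) (hx1 : x < 1) (hr0 : 0 ≤ r) (hrx : r ≤ x) (hg : x ^ 2 + (1 - x) * r ≤ 1 / 2) : r + 2 * x ≤ 2 := by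
  nlinarith [mul_nonneg (by linarith : 0 ≤ 1 - x) hr0, sq_nonneg (x - 2 / 3)]

/-- **P2 incompatible forces `γ ≥ 1/2`**: `ρ_c < x`, `r < x`, low cross `(2 − r)a < ρ_c`, and `ρ_c + ra ≥ 1` ⟹ `x² + (1−x)r ≥ 1/2`. [this work] -/
theorem half_le_gamma_of_incompatible (x r ρc a : ℝ) (hx1 : x < 1) (hr0 : 0 ≤ r) (hrx : r < x) (hρc : ρc < x)
    (hlc : (2 - r) * a < ρc) (hP : 1 ≤ ρc + r * a) : 1 / 2 ≤ x ^ 2 + (1 - x) * r := by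
  -- `a < ρc/(2-r)` so `1 ≤ ρc + ra < ρc·2/(2-r)`, i.e. `ρc > 1 - r/2`, hence `r > 2(1-x)` and `γ > x² + 2(1-x)² ≥ 1/2`
  have h2r : 0 < 2 - r := by linarith
  have hra : r * a * (2 - r) ≤ r * ρc := by nlinarith [mul_nonneg hr0 (by linarith : 0 ≤ ρc - (2 - r) * a)]
  have h1 : (2 - r) ≤ (2 - r) * ρc + r * ρc := by nlinarith
  have hρc2 : 1 - r / 2 ≤ ρc := by
    have : 2 - r ≤ 2 * ρc := by nlinarith
    linarith
  have hr2 : 2 * (1 - x) < r := by linarith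
  nlinarith [sq_nonneg (x - 2 / 3), mul_nonneg (by linarith : 0 ≤ 1 - x) (by linarith : 0 ≤ r - 2 * (1 - x))]

/-- `U_ℓ(ρ) ≤ u` for `ρ ≤ x`: a light pair uses at most the giant rate. -/
theorem Ul_le_u (x ρ : ℝ) (hx0 : 0 < x) (hx1 : x < 1) (hρ : ρ ≤ x) :
    (x ^ 2 + (1 - x) * ρ) / ((1 - x) * (1 + x - ρ)) ≤ x / (1 - x) := by
  have h1x : 0 < 1 - x := by linarith
  rw [div_le_div_iff₀ (mul_pos h1x (by linarith)) h1x]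
  nlinarith [mul_nonneg h1x.le (by linarith : 0 ≤ x - ρ)]

/-- the cleared core of (★) below `γ = 1/2`: `(1 − 2γ)(P − x)(1 + x − M) ≤ γ(x − M)(1 − P)`. -/
theorem star_core (x r ρc a P M γ : ℝ) (hx0 : 0 < x) (hx1 : x < 1) (hr0 : 0 ≤ r) (hrx : r < x)
    (hρcx : ρc < x) (ha0 : 0 < a) (hlc : (2 - r) * a < ρc)
    (hP : P = ρc + r * a) (hPx : x ≤ P) (hP1 : P < 1) (hM : M = (P - 2 * a) / (1 - a))
    (hγ : γ = x ^ 2 + (1 - x) * r) (hg : γ < 1 / 2) :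
    (1 - 2 * γ) * (P - x) * (1 + x - M) ≤ γ * (x - M) * (1 - P) := by
  have h1x : 0 < 1 - x := by linarith
  have ha1 : a < 1 := by nlinarith
  have h1a : 0 < 1 - a := by linarith
  have hδ : P - x ≤ r * a := by rw [hP]; linarith
  have hMx : M < x := by
    rw [hM, div_lt_iff₀ h1a]; nlinarith [mul_pos ha0 h1x]
  have hMden : 0 < 1 + x - M := by linarith
  have hγ0 : 0 ≤ γ := by rw [hγ]; positivity
  have hxM : (1 - a) * (x - M) = 2 * a - x * a - (P - x) := by
    have : (1 : ℝ) - a ≠ 0 := h1a.ne'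
    rw [hM]; field_simp; ring
  have hxM' : (1 - a) * (1 + x - M) = 1 + a - x * a - (P - x) := by
    have : (1 : ℝ) - a ≠ 0 := h1a.ne'
    rw [hM]; field_simp; ring
  have hss := starstar_cert x r a hx0 hx1 hr0 hrx.le ha0.le (by linarith only [hlc, hρcx]) (by rw [← hγ]; exact hg.le)
  rw [← hγ] at hss
  have h2x : r + 2 * x ≤ 2 := r_add_two_x_le x r hx1 hr0 hrx.le (by rw [← hγ]; exact hg.le)
  have hra2 : r * ((2 - r) * a) ≤ r * x := mul_le_mul_of_nonneg_left (le_of_lt (lt_trans hlc hρcx)) hr0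
  have hra1 : 0 ≤ 1 - x - r * a := by
    have h2r : 0 < 2 - r := by linarith only [hrx, hx1]
    have key : (2 - r) * (r * a) ≤ (2 - r) * (1 - x) := by linarith only [hra2, h2x]
    have := le_of_mul_le_mul_left key h2r
    linarith only [this]
  have hδ0 : 0 ≤ P - x := by linarith only [hPx]
  have h12 : 0 ≤ 1 - 2 * γ := by linarith only [hg]
  have core' : (1 - 2 * γ) * (P - x) * (1 + a - x * a - (P - x)) ≤ γ * (2 * a - x * a - (P - x)) * (1 - P) := by
    calc (1 - 2 * γ) * (P - x) * (1 + a - x * a - (P - x))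
        ≤ (1 - 2 * γ) * (r * a) * (1 + a) := by
          have i1 : (1 - 2 * γ) * (P - x) ≤ (1 - 2 * γ) * (r * a) := mul_le_mul_of_nonneg_left hδ h12
          have i2 : 1 + a - x * a - (P - x) ≤ 1 + a := by linarith only [mul_nonneg hx0.le ha0.le, hδ0]
          have i3 : 0 ≤ 1 + a - x * a - (P - x) := by rw [← hxM']; exact (mul_pos h1a hMden).le
          calc (1 - 2 * γ) * (P - x) * (1 + a - x * a - (P - x))
              ≤ (1 - 2 * γ) * (r * a) * (1 + a - x * a - (P - x)) := mul_le_mul_of_nonneg_right i1 i3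
            _ ≤ (1 - 2 * γ) * (r * a) * (1 + a) :=
                mul_le_mul_of_nonneg_left i2 (mul_nonneg h12 (mul_nonneg hr0 ha0.le))
      _ = a * ((1 - 2 * γ) * r * (1 + a)) := by ring
      _ ≤ a * (γ * (2 - x - r) * (1 - x - r * a)) := mul_le_mul_of_nonneg_left hss ha0.le
      _ = γ * (a * (2 - x - r)) * (1 - x - r * a) := by ring
      _ ≤ γ * (2 * a - x * a - (P - x)) * (1 - P) := by
          have j1 : a * (2 - x - r) ≤ 2 * a - x * a - (P - x) := by linarith only [hδ]
          have j2 : 1 - x - r * a ≤ 1 - P := by linarith only [hδ]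
          calc γ * (a * (2 - x - r)) * (1 - x - r * a) ≤ γ * (2 * a - x * a - (P - x)) * (1 - x - r * a) :=
                mul_le_mul_of_nonneg_right (mul_le_mul_of_nonneg_left j1 hγ0) hra1
            _ ≤ γ * (2 * a - x * a - (P - x)) * (1 - P) :=
                mul_le_mul_of_nonneg_left j2 (mul_nonneg hγ0 (by
                  linarith only [hδ, mul_nonneg ha0.le (show (0:ℝ) ≤ 2 - x - r by linarith only [hx1, hrx])]))
  have hmul : (1 - a) * ((1 - 2 * γ) * (P - x) * (1 + x - M)) ≤ (1 - a) * (γ * (x - M) * (1 - P)) := by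
    calc (1 - a) * ((1 - 2 * γ) * (P - x) * (1 + x - M))
        = (1 - 2 * γ) * (P - x) * ((1 - a) * (1 + x - M)) := by ring
      _ = (1 - 2 * γ) * (P - x) * (1 + a - x * a - (P - x)) := by rw [hxM']
      _ ≤ γ * (2 * a - x * a - (P - x)) * (1 - P) := core'
      _ = γ * ((1 - a) * (x - M)) * (1 - P) := by rw [hxM]
      _ = (1 - a) * (γ * (x - M) * (1 - P)) := by ring
  exact le_of_mul_le_mul_left hmul h1a

/-- **(★) in the rates.**  See the module docstring. [this work] -/
theorem star_of_rates (x r ρc a P M γ u c₂ cP cM : ℝ) (hx0 : 0 < x) (hx1 : x < 1) (hr0 : 0 ≤ r) (hrx : r < x)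
    (hρc0 : 0 ≤ ρc) (hρcx : ρc < x) (ha0 : 0 < a) (hlc : (2 - r) * a < ρc)
    (hP : P = ρc + r * a) (hPx : x ≤ P) (hP1 : P < 1) (hM : M = (P - 2 * a) / (1 - a))
    (hγ : γ = x ^ 2 + (1 - x) * r) (hu : u = x / (1 - x))
    (hc₂ : c₂ = (x ^ 2 + (1 - x) * ρc) / ((1 - x) * (1 + x - ρc))) (hcP : cP = P / (1 - P))
    (hcM : cM = (x ^ 2 + (1 - x) * M) / ((1 - x) * (1 + x - M))) :
    (1 - γ) * c₂ * (cP - u) ≤ u * γ * (cP - cM) := by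
  have h1x : 0 < 1 - x := by linarith
  have ha1 : a < 1 := by nlinarith
  have h1a : 0 < 1 - a := by linarith
  have hδ : P - x ≤ r * a := by rw [hP]; linarith
  have hMx : M < x := by
    rw [hM, div_lt_iff₀ h1a]; nlinarith [mul_pos ha0 h1x]
  have hMden : 0 < 1 + x - M := by linarith
  have hγ0 : 0 ≤ γ := by rw [hγ]; positivity
  have hγ1 : γ ≤ 1 := by rw [hγ]; nlinarith
  have hu0 : 0 < u := by rw [hu]; exact div_pos hx0 h1x
  have hc₂u : c₂ ≤ u := by rw [hc₂, hu]; exact Ul_le_u x ρc hx0 hx1 hρcx.le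
  have hc₂0 : 0 ≤ c₂ := by rw [hc₂]; exact div_nonneg (by positivity) (mul_pos h1x (by linarith)).le
  have hcMu : cM ≤ u := by rw [hcM, hu]; exact Ul_le_u x M hx0 hx1 hMx.le
  have hucP : u ≤ cP := by
    rw [hcP, hu, div_le_div_iff₀ h1x (by linarith)]
    nlinarith
  by_cases hg : 1 / 2 ≤ γ
  · -- `(1-γ)c₂ ≤ γu` and `cP - u ≤ cP - cM`
    calc (1 - γ) * c₂ * (cP - u) ≤ (γ * u) * (cP - u) := by
          apply mul_le_mul_of_nonneg_right _ (by linarith)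
          nlinarith [mul_nonneg (by linarith : 0 ≤ 1 - γ) hc₂0]
      _ ≤ u * γ * (cP - cM) := by nlinarith [mul_nonneg hu0.le hγ0]
  · push Not at hg
    have core := star_core x r ρc a P M γ hx0 hx1 hr0 hrx hρcx ha0 hlc hP hPx hP1 hM hγ hg
    -- reduce to `(1 - 2γ)(cP - u) ≤ γ (u - cM)`
    suffices key : (1 - 2 * γ) * (cP - u) ≤ γ * (u - cM) by
      have h1 : (1 - γ) * c₂ * (cP - u) ≤ (1 - γ) * u * (cP - u) := by
        have := mul_le_mul_of_nonneg_left hc₂u (by linarith : 0 ≤ 1 - γ)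
        exact mul_le_mul_of_nonneg_right this (by linarith)
      nlinarith [mul_le_mul_of_nonneg_left key hu0.le]
    have hP1' : (1 : ℝ) - P ≠ 0 := by linarith
    have h1x' : (1 : ℝ) - x ≠ 0 := h1x.ne'
    have hMden' : (1 : ℝ) + x - M ≠ 0 := hMden.ne'
    have eP : cP - u = (P - x) / ((1 - P) * (1 - x)) := by
      rw [hcP, hu]; field_simp; ring
    have eM : u - cM = (x - M) / ((1 - x) * (1 + x - M)) := by
      rw [hcM, hu]; field_simp; ring
    have hD1 : (1 - P) * (1 - x) ≠ 0 := mul_ne_zero hP1' h1x'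
    have hD2 : (1 - x) * (1 + x - M) ≠ 0 := mul_ne_zero h1x' hMden'
    have hD : (1 - P) * (1 - x) * (1 + x - M) ≠ 0 := mul_ne_zero hD1 hMden'
    have lhs_eq : (1 - 2 * γ) * (cP - u) = ((1 - 2 * γ) * (P - x) * (1 + x - M)) / ((1 - P) * (1 - x) * (1 + x - M)) := by
      rw [eP, ← mul_div_assoc, div_eq_div_iff hD1 hD]; ring
    have rhs_eq : γ * (u - cM) = (γ * (x - M) * (1 - P)) / ((1 - P) * (1 - x) * (1 + x - M)) := by
      rw [eM, ← mul_div_assoc, div_eq_div_iff hD2 hD]; ring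
    have hP1pos : (0 : ℝ) < 1 - P := sub_pos.mpr hP1
    have hDpos : (0 : ℝ) < (1 - P) * (1 - x) * (1 + x - M) := mul_pos (mul_pos hP1pos h1x) hMden
    calc (1 - 2 * γ) * (cP - u) = ((1 - 2 * γ) * (P - x) * (1 + x - M)) / ((1 - P) * (1 - x) * (1 + x - M)) := lhs_eq
      _ ≤ (γ * (x - M) * (1 - P)) / ((1 - P) * (1 - x) * (1 + x - M)) := (div_le_div_iff_of_pos_right hDpos).2 core
      _ = γ * (u - cM) := rhs_eq.symm

/-- **THE TWO-TERM KNAPSACK BOUND** (the `M2` and `P2` terms of the balanced knapsack inequality dominate the mid):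
`0 < u`, `0 ≤ γ ≤ 1`, `0 ≤ c₂ ≤ u`, `c_M ≤ u`; when `P2` is compatible, `u ≤ c_P → (★)`; when it is not, `γ ≥ 1/2`.  Then for every `θ ≥ 0`:
`γ·min(c_M, θ) + (1−γ)·(compatible ? min(c_P, θ) : θ) ≤ (1−γ)·c₂·(1 − θ/u) + θ`. [this work] -/
theorem twoTerm_knapsack (u γ c₂ cM cP : ℝ) (compat : Prop) [Decidable compat] (hu0 : 0 < u) (hγ0 : 0 ≤ γ) (hγ1 : γ ≤ 1)
    (hc₂0 : 0 ≤ c₂) (hc₂u : c₂ ≤ u) (hcMu : cM ≤ u)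
    (hstar : compat → u ≤ cP → (1 - γ) * c₂ * (cP - u) ≤ u * γ * (cP - cM))
    (hinc : ¬ compat → 1 / 2 ≤ γ) (θ : ℝ) :
    γ * min cM θ + (1 - γ) * (if compat then min cP θ else θ) ≤ (1 - γ) * c₂ * (1 - θ / u) + θ := by
  have hmin : min cM θ ≤ θ := min_le_right _ _
  have h1γ : 0 ≤ 1 - γ := by linarith
  by_cases hθu : θ ≤ u
  · -- below `u` the right side exceeds `θ`
    have hR : 0 ≤ (1 - γ) * c₂ * (1 - θ / u) :=
      mul_nonneg (mul_nonneg h1γ hc₂0) (by rw [sub_nonneg, div_le_one hu0]; exact hθu)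
    have hF : (if compat then min cP θ else θ) ≤ θ := by split_ifs; exacts [min_le_right _ _, le_rfl]
    nlinarith [mul_le_mul_of_nonneg_left hmin hγ0, mul_le_mul_of_nonneg_left hF h1γ]
  push Not at hθu
  have hminM : min cM θ = cM := min_eq_left (hcMu.trans hθu.le)
  rw [hminM]
  -- common rewriting: goal ⟺ (1-γ)c₂(θ/u - 1) ≤ γ(θ - cM) + (1-γ)(θ - F)
  by_cases hc : compat
  · rw [if_pos hc]
    by_cases hPu : cP ≤ u
    · -- light `P2`: `(θ - min(cP,θ)) ≥ θ - u`
      have hF : min cP θ ≤ u := (min_le_left _ _).trans hPu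
      -- (1-γ)c₂(θ/u-1) ≤ (θ-u)·c₂/u·(1-γ) ≤ (1-γ)(θ-u) ≤ (1-γ)(θ - min cP θ); and γ(θ - cM) ≥ 0... combine
      have e : (1 - γ) * c₂ * (1 - θ / u) = -((1 - γ) * (c₂ / u) * (θ - u)) := by field_simp; ring
      rw [e]
      have k1 : (1 - γ) * (c₂ / u) * (θ - u) ≥ (0 : ℝ) := by
        exact mul_nonneg (mul_nonneg h1γ (div_nonneg hc₂0 hu0.le)) (by linarith)
      have k2 : (c₂ / u) ≤ 1 := by rw [div_le_one hu0]; exact hc₂u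
      have k3 : (1 - γ) * (c₂ / u) * (θ - u) ≤ (1 - γ) * (θ - u) := by
        have := mul_le_mul_of_nonneg_left k2 h1γ
        nlinarith [mul_le_mul_of_nonneg_right this (by linarith : 0 ≤ θ - u)]
      nlinarith [mul_nonneg hγ0 (by linarith : 0 ≤ θ - cM), mul_le_mul_of_nonneg_left hF h1γ]
    · push Not at hPu
      have hst := hstar hc hPu.le
      -- convexity in θ: check θ ≤ cP (affine, endpoints u and cP) and θ ≥ cP (slope)
      by_cases hθP : θ ≤ cP
      · rw [min_eq_right hθP]
        -- need: (1-γ)c₂(θ/u - 1) ≤ γ(θ - cM); at θ=u: 0 ≤ γ(u-cM); at θ=cP: (★)/u. Affine in θ ⟹ interpolate.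
        have e : (1 - γ) * c₂ * (1 - θ / u) = -((1 - γ) * c₂ * (θ - u) / u) := by field_simp; ring
        rw [e]
        -- θ = u + t (cP - u), t ∈ [0,1]
        have hPu' : 0 < cP - u := by linarith
        set t := (θ - u) / (cP - u) with ht
        have ht0 : 0 ≤ t := div_nonneg (by linarith) hPu'.le
        have ht1 : t ≤ 1 := by rw [ht, div_le_one hPu']; linarith
        have hθt : θ - u = t * (cP - u) := by rw [ht]; field_simp
        have goal1 : (1 - γ) * c₂ * (θ - u) / u ≤ γ * (θ - cM) := by
          rw [div_le_iff₀ hu0, hθt]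
          have hθcM : θ - cM = t * (cP - u) + (u - cM) := by linarith
          rw [hθcM]
          -- t·(★) + (1-t)... : (1-γ)c₂ t (cP-u) ≤ t·uγ(cP - cM) ≤ uγ(t(cP-u) + (u - cM))·... since (1-t)γu(u-cM) ≥ 0
          have a1 : (1 - γ) * c₂ * (t * (cP - u)) = t * ((1 - γ) * c₂ * (cP - u)) := by ring
          rw [a1]
          have a2 : t * ((1 - γ) * c₂ * (cP - u)) ≤ t * (u * γ * (cP - cM)) := mul_le_mul_of_nonneg_left hst ht0
          have a3 : 0 ≤ (1 - t) * (u * γ * (u - cM)) := mul_nonneg (by linarith) (mul_nonneg (mul_nonneg hu0.le hγ0) (by linarith))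
          nlinarith
        linarith
      · push Not at hθP
        rw [min_eq_left hθP.le]
        -- beyond cP: value at cP plus slope `1 - (1-γ)c₂/u ≥ 0`
        have e : (1 - γ) * c₂ * (1 - θ / u) = -((1 - γ) * c₂ * (θ - u) / u) := by field_simp; ring
        rw [e]
        have atP : (1 - γ) * c₂ * (cP - u) / u ≤ γ * (cP - cM) := by
          rw [div_le_iff₀ hu0]; linarith
        have slope : (1 - γ) * c₂ * (θ - cP) / u ≤ (θ - cP) := by
          rw [div_le_iff₀ hu0]
          have : (1 - γ) * c₂ ≤ u := by nlinarith
          nlinarith [mul_le_mul_of_nonneg_right this (by linarith : 0 ≤ θ - cP)]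
        have split : (1 - γ) * c₂ * (θ - u) / u = (1 - γ) * c₂ * (cP - u) / u + (1 - γ) * c₂ * (θ - cP) / u := by
          field_simp; ring
        rw [split]
        nlinarith [mul_nonneg hγ0 (by linarith : 0 ≤ θ - cP)]
  · rw [if_neg hc]
    have hg := hinc hc
    -- (1-γ)c₂(θ/u - 1) ≤ γ(θ - cM): since (1-γ)c₂ ≤ γ u and θ - cM ≥ θ - u
    have e : (1 - γ) * c₂ * (1 - θ / u) = -((1 - γ) * c₂ * (θ - u) / u) := by field_simp; ring
    rw [e]
    have k : (1 - γ) * c₂ * (θ - u) / u ≤ γ * (θ - cM) := by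
      rw [div_le_iff₀ hu0]
      have k1 : (1 - γ) * c₂ ≤ γ * u := by nlinarith
      nlinarith [mul_le_mul_of_nonneg_right k1 (by linarith : 0 ≤ θ - u), mul_nonneg hγ0 (by linarith : 0 ≤ u - cM)]
    linarith

/-- **THE INCOMPATIBLE BUDGET (S)**: `(1−γ)c₂ ≤ u·(γ + (1−γ)·[P2 compatible])` from `c₂ ≤ u` and `γ ≥ 1/2` when `P2` is incompatible.
[this work] -/
theorem budget_S (u γ c₂ : ℝ) (compat : Prop) [Decidable compat] (hu0 : 0 < u) (hγ0 : 0 ≤ γ) (hγ1 : γ ≤ 1) (hc₂0 : 0 ≤ c₂)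
    (hc₂u : c₂ ≤ u) (hinc : ¬ compat → 1 / 2 ≤ γ) :
    (1 - γ) * c₂ ≤ u * (γ + (if compat then (1 - γ) else 0)) := by
  by_cases hc : compat
  · rw [if_pos hc]; nlinarith
  · rw [if_neg hc, add_zero]
    have := hinc hc
    nlinarith

end CrossGiantCell

end LawDec

end Quant

end Summit.CriticalPhenomena.PercolationContinuityZ3.Theorems
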